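import Literature.NumberTheory.LFunctions.RayClassSmoothedSums
import HarnessLib

/-!
# Smoothed sums over a coset of a congruence class group and over the multiples of an ideal
# (Thorner–Zaman 2017, Lemma 4.4 and Corollary 4.5)

Topic `Literature/NumberTheory/LFunctions`, namespace `Literature.NumberTheory.LFunctions.AbelianDensity`.
Everything here is PROVED (one definition with body, theorems; no named facts).

Continuation of `RayClassSmoothedSums.lean` (Lemma 4.3: the character sums).  For an abelian Frobenius
datum `f : 𝔭 ↦ f 𝔭 ∈ G` killing the narrow ray `mod 𝔪 ≠ 0` (`ArtinKillsRay 𝔪 f`; e.g. `G = Cl_K^𝔪`,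
`f 𝔭 = [𝔭]`, or any congruence class group `H ⊇ P^𝔪` with `G = J^𝔪/H`) whose non-trivial characters are
non-principal on the primes `∤ 𝔪` (the classes `f 𝔭` generate `G`), and `τ ∈ G`, put (Weiss's kernel
`φ = φ_{m+1}`, parameter `A`, `x = e^u`)
  `S_τ(u) = Σ_{(𝔫,𝔪)=1, F(𝔫) = τ} N𝔫^{-1} φ(u − log N𝔫)`   (`fiberSmoothedSum`),
`F` the multiplicative extension of `f` (`artinSymbol f`) — the smoothed count of the ideals in the coset
`τ` of `H`.  Then:
* `card_mul_fiberSmoothedSum_eq` — orthogonality `|G| · S_τ(u) = Σ_χ χ(τ)⁻¹ S_χ(u)`;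
* `norm_fiberSmoothedSum_sub_le` — **TZ Lemma 4.4 for a congruence class group**:
  `|S_τ(u) − κ_K φ(𝔪)/(N𝔪 |G|)| ≤ (1/3)·|d_K| N𝔪² √N𝔪 · e^{2n_K} · C · e^{−3u/2}`, `C = majorConst A m (n_K+1)`,
  `m ≥ n_K + 3` — the main term `δ(χ)κ_K φ(𝔮)/N𝔮` of Lemma 4.3 divided by `h_H = |G|`;
* `tsum_dvd_fiber_eq` — for `𝔡 ≠ 0` prime to `𝔪`: `Σ_{F(𝔫)=τ, 𝔡∣𝔫} N𝔫^{-1}φ(u − log N𝔫) = N𝔡^{-1} S_{τ F(𝔡)⁻¹}(u − log N𝔡)`;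
* `norm_tsum_dvd_fiber_sub_le` — **TZ Corollary 4.5**: `|Σ_{F(𝔫)=τ, 𝔡∣𝔫} N𝔫^{-1}φ(u − log N𝔫) − κ_K φ(𝔪)/(N𝔪 |G| N𝔡)|
  ≤ (1/3)·|d_K| N𝔪² √N𝔪 · e^{2n_K} · C · e^{−3u/2} √N𝔡` — the local input of the Selberg sieve (Lemma 4.6).
For the class group (`𝔪 = 1`) these are the tree's `ClassGroupSmoothedCosets` results.

## References
* [ThornerZaman2017] J. Thorner, A. Zaman, *An explicit bound for the least prime ideal in the Chebotarev
  density theorem*, Algebra Number Theory 11 (2017), Lemma 4.4, Corollary 4.5.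
* [Weiss1983] A. Weiss, *The least prime ideal*, J. reine angew. Math. 338 (1983), Lemma 3.4, Corollary 3.5.
-/

noncomputable section

open Complex Finset IsDedekindDomain NumberField Filter
open scoped Topology

namespace Literature.NumberTheory.LFunctions.AbelianDensity

open Literature.NumberTheory.LFunctions.WeissKernel Literature.NumberTheory.LFunctions.NumberField
open scoped nonZeroDivisors _root_.NumberField Classical

variable {K : Type*} [Field K] [NumberField K]
variable {G : Type*} [CommGroup G] [Finite G] {𝔪 : Ideal (𝓞 K)} {f : HeightOneSpectrum (𝓞 K) → G}

/-! ### Coset sums and orthogonality -/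

variable (𝔪 f) in
/-- **The smoothed sum over a coset of the congruence class group**:
`S_τ(u) = Σ_{𝔫 ≠ 0, (𝔫, 𝔪) = 1, F(𝔫) = τ} N𝔫^{-1} φ_{m+1}(u − log N𝔫)`, `F = artinSymbol f`.
[cite: ThornerZaman2017, Lemma 4.4] -/
def fiberSmoothedSum (τ : G) (A : ℝ) (m : ℕ) (u : ℝ) : ℂ :=
  ∑' I : Ideal (𝓞 K), (if I ≠ ⊥ ∧ IsCoprime I 𝔪 ∧ artinSymbol f I = τ then (1 : ℂ) else 0) *
    ((Ideal.absNorm I : ℕ) : ℂ)⁻¹ * (phi A m (u - Real.log (Ideal.absNorm I)) : ℂ)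

omit [Finite G] in
/-- The coefficient `χ(𝔫)` of `L_𝔪(s, ψ_χ)` is `χ(F(𝔫))` on the nonzero ideals prime to `𝔪`, `0` elsewhere.
[cite: ThornerZaman2017, Lemma 4.4] -/
theorem rayClassCoeff_charFun_eq (χ : AddChar (Additive G) ℂ) (I : Ideal (𝓞 K)) :
    rayClassCoeff 𝔪 (charFun f χ) I =
      if I ≠ ⊥ ∧ IsCoprime I 𝔪 then χ (Additive.ofMul (artinSymbol f I)) else 0 := by
  rw [rayClassCoeff]
  split_ifs with h
  · rw [show charFun f χ = fun v ↦ toMulHom χ (f v) from rfl, idealPow_comp_eq (toMulHom χ) f h.1,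
      toMulHom_apply]
  · rfl

/-- **Orthogonality**: `|G| · S_τ(u) = Σ_χ χ(τ)⁻¹ S_χ(u)` over the characters `χ` of `G`, where
`S_χ(u) = Σ_𝔫 χ(𝔫) N𝔫^{-1} φ(u − log N𝔫)` is the character sum of Lemma 4.3. [cite: ThornerZaman2017, Lemma 4.4] -/
theorem card_mul_fiberSmoothedSum_eq (τ : G) {A : ℝ} (hA : 0 < A) (m : ℕ) (u : ℝ) :
    (Nat.card G : ℂ) * fiberSmoothedSum 𝔪 f τ A m u =
      ∑ χ : AddChar (Additive G) ℂ, (χ (Additive.ofMul τ))⁻¹ *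
        ∑' I : Ideal (𝓞 K), rayClassCoeff 𝔪 (charFun f χ) I *
          ((Ideal.absNorm I : ℕ) : ℂ)⁻¹ * (phi A m (u - Real.log (Ideal.absNorm I)) : ℂ) := by
  rw [fiberSmoothedSum, ← tsum_mul_left]
  simp_rw [← tsum_mul_left]
  rw [← Summable.tsum_finsetSum (fun χ _ ↦ (summable_mul_phi hA m u _).mul_left _)]
  refine tsum_congr fun I ↦ ?_
  set w : ℂ := ((Ideal.absNorm I : ℕ) : ℂ)⁻¹ * (phi A m (u - Real.log (Ideal.absNorm I)) : ℂ) with hw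
  have hre : ∀ χ : AddChar (Additive G) ℂ, (χ (Additive.ofMul τ))⁻¹ *
      (rayClassCoeff 𝔪 (charFun f χ) I * ((Ideal.absNorm I : ℕ) : ℂ)⁻¹ *
        (phi A m (u - Real.log (Ideal.absNorm I)) : ℂ)) =
      ((χ (Additive.ofMul τ))⁻¹ * rayClassCoeff 𝔪 (charFun f χ) I) * w := fun χ ↦ by rw [hw]; ring
  simp only [hre]
  rw [← sum_mul, show (Nat.card G : ℂ) * ((if I ≠ ⊥ ∧ IsCoprime I 𝔪 ∧ artinSymbol f I = τ then (1 : ℂ) else 0) *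
      ((Ideal.absNorm I : ℕ) : ℂ)⁻¹ * (phi A m (u - Real.log (Ideal.absNorm I)) : ℂ)) =
      ((Nat.card G : ℂ) * (if I ≠ ⊥ ∧ IsCoprime I 𝔪 ∧ artinSymbol f I = τ then (1 : ℂ) else 0)) * w by
    rw [hw]; ring]
  congr 1
  by_cases hI : I ≠ ⊥ ∧ IsCoprime I 𝔪
  · have hχ : ∀ χ : AddChar (Additive G) ℂ, χ (Additive.ofMul (artinSymbol f I)) = toMulHom χ (artinSymbol f I) :=
      fun χ ↦ rfl
    simp only [rayClassCoeff_charFun_eq, if_pos hI, hχ, sum_char_inv_mul]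
    by_cases hτ : artinSymbol f I = τ
    · rw [if_pos hτ, if_pos ⟨hI.1, hI.2, hτ⟩, mul_one]
    · rw [if_neg hτ, if_neg (fun h ↦ hτ h.2.2), mul_zero]
  · simp only [rayClassCoeff_charFun_eq, if_neg hI, mul_zero, sum_const_zero]
    rw [if_neg (fun h ↦ hI ⟨h.1, h.2.1⟩), mul_zero]

omit [Finite G] in
/-- The character sum over ideals is the `smoothedSum` of the Dirichlet coefficients of `L_𝔪(s, ψ)` (regrouping
by norms; any `ψ`). [cite: ThornerZaman2017, Lemma 4.4] -/
theorem smoothedSum_rayClassCoeff_eq_tsum (ψ : HeightOneSpectrum (𝓞 K) → ℂ) {A : ℝ} (hA : 0 < A) (m : ℕ) (u : ℝ) :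
    smoothedSum (fun n ↦ ∑ I ∈ (Ideal.finite_setOf_absNorm_eq (S := 𝓞 K) n).toFinset,
        rayClassCoeff 𝔪 ψ I) A m u =
      ∑' I : Ideal (𝓞 K), rayClassCoeff 𝔪 ψ I *
        ((Ideal.absNorm I : ℕ) : ℂ)⁻¹ * (phi A m (u - Real.log (Ideal.absNorm I)) : ℂ) := by
  have h := (summable_mul_phi hA m u (rayClassCoeff 𝔪 ψ)).hasSum.tsum_fiberwise
    (Ideal.absNorm : Ideal (𝓞 K) → ℕ)
  rw [smoothedSum, ← h.tsum_eq]
  refine tsum_congr fun n ↦ ?_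
  rw [eq_comm, tsum_absNorm_fiber_eq_sum (fun I : Ideal (𝓞 K) ↦ rayClassCoeff 𝔪 ψ I *
    ((Ideal.absNorm I : ℕ) : ℂ)⁻¹ * (phi A m (u - Real.log (Ideal.absNorm I)) : ℂ)) n,
    Finset.sum_mul, Finset.sum_mul]
  refine Finset.sum_congr rfl fun I hI ↦ ?_
  rw [Set.Finite.mem_toFinset, Set.mem_setOf_eq] at hI
  rw [hI]

/-- `|Ĝ| = |G|`. [cite: ThornerZaman2017, Lemma 4.4] -/
private theorem card_addChar_eq : (Finset.univ : Finset (AddChar (Additive G) ℂ)).card = Nat.card G := by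
  letI : Fintype G := Fintype.ofFinite G
  rw [Finset.card_univ, AddChar.card_eq, Nat.card_eq_fintype_card, Fintype.card_congr (Additive.toMul (α := G))]

/-- **Thorner–Zaman Lemma 4.4 for a congruence class group `mod 𝔪`.**  Let `f` be an abelian Frobenius
datum killing the narrow ray `mod 𝔪 ≠ 0` whose non-trivial characters are non-principal on the primes `∤ 𝔪`,
`m ≥ n_K + 3`, `A > 0`.  Then for every `τ ∈ G` and real `u`,
`|S_τ(u) − κ_K φ(𝔪)/(N𝔪·|G|)| ≤ (1/3)·|d_K| N𝔪² √N𝔪 · e^{2n_K} · C · e^{−3u/2}`, `C = majorConst A m (n_K+1)`.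
[cite: ThornerZaman2017, Lemma 4.4] -/
theorem norm_fiberSmoothedSum_sub_le (h𝔪 : 𝔪 ≠ ⊥) (hray : ArtinKillsRay 𝔪 f)
    (hsep : ∀ χ : AddChar (Additive G) ℂ, χ ≠ 0 →
      ∃ v : HeightOneSpectrum (𝓞 K), ¬ 𝔪 ≤ v.asIdeal ∧ χ (Additive.ofMul (f v)) ≠ 1)
    (τ : G) {A : ℝ} (hA : 0 < A) {m : ℕ} (hm : Module.finrank ℚ K + 3 ≤ m) (u : ℝ) :
    ‖fiberSmoothedSum 𝔪 f τ A m u - coprimeResidue K 𝔪 h𝔪 / Nat.card G‖ ≤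
      1 / 3 * ((((NumberField.discr K).natAbs : ℝ) * ((Ideal.absNorm 𝔪 : ℕ) : ℝ) ^ 2 *
        Real.sqrt (Ideal.absNorm 𝔪 : ℕ)) * Real.exp (2 * Module.finrank ℚ K)) *
        majorConst A m (Module.finrank ℚ K + 1) * Real.exp (-(3 / 2 * u)) := by
  set h : ℕ := Nat.card G with hh
  have hhpos : 0 < h := Nat.card_pos
  have hh0 : (h : ℂ) ≠ 0 := by exact_mod_cast hhpos.ne'
  have hhR : (0 : ℝ) < h := by exact_mod_cast hhpos
  set err : ℝ := 1 / 3 * ((((NumberField.discr K).natAbs : ℝ) * ((Ideal.absNorm 𝔪 : ℕ) : ℝ) ^ 2 *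
        Real.sqrt (Ideal.absNorm 𝔪 : ℕ)) * Real.exp (2 * Module.finrank ℚ K)) *
        majorConst A m (Module.finrank ℚ K + 1) * Real.exp (-(3 / 2 * u)) with herr
  set κ : ℝ := coprimeResidue K 𝔪 h𝔪 with hκ
  -- per character error
  set S : AddChar (Additive G) ℂ → ℂ := fun χ ↦ ∑' I : Ideal (𝓞 K), rayClassCoeff 𝔪 (charFun f χ) I *
      ((Ideal.absNorm I : ℕ) : ℂ)⁻¹ * (phi A m (u - Real.log (Ideal.absNorm I)) : ℂ) with hS
  set E : AddChar (Additive G) ℂ → ℂ := fun χ ↦ S χ - if χ = 0 then (κ : ℂ) else 0 with hE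
  have hEle : ∀ χ, ‖E χ‖ ≤ err := by
    intro χ
    rw [hE]; dsimp only
    rw [hS]; dsimp only
    rw [← smoothedSum_rayClassCoeff_eq_tsum (charFun f χ) hA m u]
    by_cases hχ : χ = 0
    · rw [if_pos hχ, hχ, show charFun f (0 : AddChar (Additive G) ℂ) = fun _ ↦ (1 : ℂ) by
        funext v; simp [charFun]]
      refine (norm_smoothedSum_one_sub_coprimeResidue_le h𝔪 hA hm u).trans ?_
      rw [herr]
      have hN1 : (1 : ℝ) ≤ ((Ideal.absNorm 𝔪 : ℕ) : ℝ) := by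
        exact_mod_cast Nat.one_le_iff_ne_zero.mpr (by rwa [Ne, Ideal.absNorm_eq_zero_iff])
      have hC := (majorConst_pos A m (Module.finrank ℚ K + 1)).le
      have : ((Ideal.absNorm 𝔪 : ℕ) : ℝ) ≤ ((Ideal.absNorm 𝔪 : ℕ) : ℝ) ^ 2 := by nlinarith
      gcongr
    · rw [if_neg hχ, sub_zero]
      exact norm_smoothedSum_charFun_le h𝔪 hray χ (hsep χ hχ) hA hm u
  -- main terms: only `χ = 0` contributes
  have hmain : ∑ χ : AddChar (Additive G) ℂ, (χ (Additive.ofMul τ))⁻¹ * (if χ = 0 then (κ : ℂ) else 0) = κ := by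
    rw [Finset.sum_eq_single (0 : AddChar (Additive G) ℂ)]
    · simp
    · intro χ _ hχ; rw [if_neg hχ, mul_zero]
    · intro h0; exact absurd (Finset.mem_univ _) h0
  have hkey : (h : ℂ) * (fiberSmoothedSum 𝔪 f τ A m u - κ / h) =
      ∑ χ : AddChar (Additive G) ℂ, (χ (Additive.ofMul τ))⁻¹ * E χ := by
    rw [mul_sub, hh, card_mul_fiberSmoothedSum_eq τ hA m u, ← hh, mul_div_cancel₀ _ hh0, ← hmain,
      ← Finset.sum_sub_distrib]
    refine Finset.sum_congr rfl fun χ _ ↦ ?_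
    rw [hE]; ring
  have hnorm : ‖(h : ℂ) * (fiberSmoothedSum 𝔪 f τ A m u - κ / h)‖ ≤ h * err := by
    rw [hkey]
    refine (norm_sum_le _ _).trans ?_
    calc ∑ χ : AddChar (Additive G) ℂ, ‖(χ (Additive.ofMul τ))⁻¹ * E χ‖
        ≤ ∑ _χ : AddChar (Additive G) ℂ, err := by
          refine Finset.sum_le_sum fun χ _ ↦ ?_
          rw [norm_mul, norm_inv, AddChar.norm_apply, inv_one, one_mul]
          exact hEle χ
      _ = h * err := by rw [Finset.sum_const, nsmul_eq_mul, card_addChar_eq]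
  rw [norm_mul, Complex.norm_natCast] at hnorm
  exact le_of_mul_le_mul_left hnorm hhR

/-! ### Sums over the multiples of an ideal prime to `𝔪` in a coset -/

omit [Finite G] in
/-- **`𝔫 = 𝔡𝔠`: the smoothed sum over the multiples of an ideal `𝔡 ≠ 0` prime to `𝔪` in the coset `τ` is
`N𝔡^{-1} S_{τ F(𝔡)⁻¹}(u − log N𝔡)`** (`𝔠 ↦ 𝔡𝔠` is a bijection onto the multiples of `𝔡`; `𝔡𝔠` is prime to
`𝔪` iff `𝔠` is; `N(𝔡𝔠) = N𝔡 N𝔠`, `F(𝔡𝔠) = F(𝔡)F(𝔠)`). [cite: ThornerZaman2017, Corollary 4.5] -/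
theorem tsum_dvd_fiber_eq {𝔡 : Ideal (𝓞 K)} (h𝔡 : 𝔡 ≠ ⊥) (h𝔡𝔪 : IsCoprime 𝔡 𝔪) (τ : G) {A : ℝ}
    (m : ℕ) (u : ℝ) :
    ∑' I : Ideal (𝓞 K), (if 𝔡 ∣ I ∧ I ≠ ⊥ ∧ IsCoprime I 𝔪 ∧ artinSymbol f I = τ then (1 : ℂ) else 0) *
        ((Ideal.absNorm I : ℕ) : ℂ)⁻¹ * (phi A m (u - Real.log (Ideal.absNorm I)) : ℂ) =
      ((Ideal.absNorm 𝔡 : ℕ) : ℂ)⁻¹ *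
        fiberSmoothedSum 𝔪 f (τ * (artinSymbol f 𝔡)⁻¹) A m (u - Real.log (Ideal.absNorm 𝔡)) := by
  set g : Ideal (𝓞 K) → ℂ := fun I ↦ (if 𝔡 ∣ I ∧ I ≠ ⊥ ∧ IsCoprime I 𝔪 ∧ artinSymbol f I = τ then (1 : ℂ) else 0) *
    ((Ideal.absNorm I : ℕ) : ℂ)⁻¹ * (phi A m (u - Real.log (Ideal.absNorm I)) : ℂ) with hg
  have hinj : Function.Injective fun J : Ideal (𝓞 K) ↦ 𝔡 * J :=
    mul_right_injective₀ (by rwa [Ne, Submodule.zero_eq_bot])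
  have hsupp : Function.support g ⊆ Set.range fun J : Ideal (𝓞 K) ↦ 𝔡 * J := by
    intro I hI
    rw [Function.mem_support, hg] at hI
    by_contra hr
    apply hI
    dsimp only
    rw [if_neg, zero_mul, zero_mul]
    rintro ⟨⟨J, hJ⟩, -, -⟩
    exact hr ⟨J, hJ.symm⟩
  rw [show (∑' I : Ideal (𝓞 K), (if 𝔡 ∣ I ∧ I ≠ ⊥ ∧ IsCoprime I 𝔪 ∧ artinSymbol f I = τ then (1 : ℂ) else 0) *
      ((Ideal.absNorm I : ℕ) : ℂ)⁻¹ * (phi A m (u - Real.log (Ideal.absNorm I)) : ℂ)) = ∑' I, g I from rfl,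
    ← hinj.tsum_eq hsupp, fiberSmoothedSum, ← tsum_mul_left]
  refine tsum_congr fun J ↦ ?_
  have hN𝔡 : (0 : ℝ) < (Ideal.absNorm 𝔡 : ℕ) := by
    exact_mod_cast Nat.pos_of_ne_zero (mt Ideal.absNorm_eq_zero_iff.mp h𝔡)
  by_cases hJ : J = ⊥
  · subst hJ
    simp [hg]
  · have hNJ : (0 : ℝ) < (Ideal.absNorm J : ℕ) := by
      exact_mod_cast Nat.pos_of_ne_zero (mt Ideal.absNorm_eq_zero_iff.mp hJ)
    have hcop : IsCoprime (𝔡 * J) 𝔪 ↔ IsCoprime J 𝔪 :=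
      ⟨fun hc ↦ hc.of_mul_left_right, fun hc ↦ IsCoprime.mul_left h𝔡𝔪 hc⟩
    have hcond : (𝔡 ∣ 𝔡 * J ∧ 𝔡 * J ≠ ⊥ ∧ IsCoprime (𝔡 * J) 𝔪 ∧ artinSymbol f (𝔡 * J) = τ) ↔
        (J ≠ ⊥ ∧ IsCoprime J 𝔪 ∧ artinSymbol f J = τ * (artinSymbol f 𝔡)⁻¹) := by
      rw [artinSymbol_mul f h𝔡 hJ, hcop]
      constructor
      · rintro ⟨-, -, h3, h4⟩
        exact ⟨hJ, h3, by rw [← h4, mul_comm (artinSymbol f 𝔡) _, mul_inv_cancel_right]⟩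
      · rintro ⟨-, h2, h3⟩
        exact ⟨dvd_mul_right _ _, mul_ne_zero h𝔡 hJ, h2, by rw [h3, mul_comm τ _, mul_inv_cancel_left]⟩
    rw [hg]; dsimp only
    rw [if_congr hcond rfl rfl, map_mul, Nat.cast_mul, Nat.cast_mul, Real.log_mul hN𝔡.ne' hNJ.ne',
      mul_inv, show u - (Real.log (Ideal.absNorm 𝔡 : ℕ) + Real.log (Ideal.absNorm J : ℕ)) =
        u - Real.log (Ideal.absNorm 𝔡 : ℕ) - Real.log (Ideal.absNorm J : ℕ) by ring]
    ring

/-- **Thorner–Zaman Corollary 4.5 for a congruence class group `mod 𝔪`**: for `𝔡 ≠ 0` prime to `𝔪`, a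
coset `τ`, `m ≥ n_K + 3` and every real `u`,
`|Σ_{F(𝔫)=τ, 𝔡∣𝔫} N𝔫^{-1} φ(u − log N𝔫) − κ_K φ(𝔪)/(N𝔪 |G| N𝔡)| ≤ (1/3)|d_K| N𝔪² √N𝔪 e^{2n_K} C e^{−3u/2} √N𝔡`.
[cite: ThornerZaman2017, Corollary 4.5] -/
theorem norm_tsum_dvd_fiber_sub_le (h𝔪 : 𝔪 ≠ ⊥) (hray : ArtinKillsRay 𝔪 f)
    (hsep : ∀ χ : AddChar (Additive G) ℂ, χ ≠ 0 →
      ∃ v : HeightOneSpectrum (𝓞 K), ¬ 𝔪 ≤ v.asIdeal ∧ χ (Additive.ofMul (f v)) ≠ 1)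
    {𝔡 : Ideal (𝓞 K)} (h𝔡 : 𝔡 ≠ ⊥) (h𝔡𝔪 : IsCoprime 𝔡 𝔪) (τ : G) {A : ℝ} (hA : 0 < A) {m : ℕ}
    (hm : Module.finrank ℚ K + 3 ≤ m) (u : ℝ) :
    ‖(∑' I : Ideal (𝓞 K), (if 𝔡 ∣ I ∧ I ≠ ⊥ ∧ IsCoprime I 𝔪 ∧ artinSymbol f I = τ then (1 : ℂ) else 0) *
        ((Ideal.absNorm I : ℕ) : ℂ)⁻¹ * (phi A m (u - Real.log (Ideal.absNorm I)) : ℂ)) -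
        coprimeResidue K 𝔪 h𝔪 / Nat.card G / (Ideal.absNorm 𝔡 : ℕ)‖ ≤
      1 / 3 * ((((NumberField.discr K).natAbs : ℝ) * ((Ideal.absNorm 𝔪 : ℕ) : ℝ) ^ 2 *
        Real.sqrt (Ideal.absNorm 𝔪 : ℕ)) * Real.exp (2 * Module.finrank ℚ K)) *
        majorConst A m (Module.finrank ℚ K + 1) * Real.exp (-(3 / 2 * u)) *
          Real.sqrt (Ideal.absNorm 𝔡 : ℕ) := by
  have hN : (0 : ℝ) < (Ideal.absNorm 𝔡 : ℕ) := by
    exact_mod_cast Nat.pos_of_ne_zero (mt Ideal.absNorm_eq_zero_iff.mp h𝔡)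
  have hNC : ((Ideal.absNorm 𝔡 : ℕ) : ℂ) ≠ 0 := by exact_mod_cast hN.ne'
  rw [tsum_dvd_fiber_eq h𝔡 h𝔡𝔪 τ m u]
  set τ' := τ * (artinSymbol f 𝔡)⁻¹
  have e : ((Ideal.absNorm 𝔡 : ℕ) : ℂ)⁻¹ * fiberSmoothedSum 𝔪 f τ' A m (u - Real.log (Ideal.absNorm 𝔡)) -
      coprimeResidue K 𝔪 h𝔪 / Nat.card G / (Ideal.absNorm 𝔡 : ℕ) =
      ((Ideal.absNorm 𝔡 : ℕ) : ℂ)⁻¹ *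
        (fiberSmoothedSum 𝔪 f τ' A m (u - Real.log (Ideal.absNorm 𝔡)) - coprimeResidue K 𝔪 h𝔪 / Nat.card G) := by
    field_simp
  rw [e, norm_mul, norm_inv, Complex.norm_natCast]
  have h := norm_fiberSmoothedSum_sub_le h𝔪 hray hsep τ' hA hm (u - Real.log (Ideal.absNorm 𝔡))
  refine (mul_le_mul_of_nonneg_left h (by positivity)).trans (le_of_eq ?_)
  have hexp : Real.exp (-(3 / 2 * (u - Real.log (Ideal.absNorm 𝔡 : ℕ)))) =
      Real.exp (-(3 / 2 * u)) * ((Ideal.absNorm 𝔡 : ℕ) : ℝ) * Real.sqrt (Ideal.absNorm 𝔡 : ℕ) := by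
    rw [show -(3 / 2 * (u - Real.log (Ideal.absNorm 𝔡 : ℕ))) =
      -(3 / 2 * u) + Real.log (Ideal.absNorm 𝔡 : ℕ) + (1 / 2) * Real.log (Ideal.absNorm 𝔡 : ℕ) by ring,
      Real.exp_add, Real.exp_add, Real.exp_log hN, Real.sqrt_eq_rpow, Real.rpow_def_of_pos hN]
    ring_nf
  rw [hexp]
  field_simp

end Literature.NumberTheory.LFunctions.AbelianDensity

end
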